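import Summits.RiemannHypothesis.RiemannHypothesis.Theorems.Splittings.LiDescentCountingLawRH
import HarnessLib

/-!
# The COUNTING-FUNCTION GAP LAW for Li descents and the kernel RH-equivalent (SketchG8 §4)

Cell rh-split, seat rh-split-li-bridge g8 (brief sha16 f79c5f09d8bcb036), card `run/shared/lean/pub/rh-split/cards/SPLIT-li-bridge.md` §15;
kernel source `HOME/rh-split-li-bridge/SketchG8.lean` sha16 7af98f60a743c35d (672 l, farm rc 0, std axioms), cut by the seat at the scratch's
section boundaries, decl text byte-verbatim; deltas = namespace `RhSplit.LiBridgeG8` ↦ `…Theorems.Splittings.LiDescentCountingLaw`, imports,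
module docstrings.  Tree inputs only: lane (xi)(c)–(f) (`LiLowZeroBudget.blockLaw_budget_clause`, `LiIncrHighPart.highPart_lower`,
`LiIncrBlockLawOfRH.lowSum_eq/reindex_nat/eventually_sqrt_log_le`, `LiIncrBlockLaw.TLi3.card_neg_mul_sq_le`, `LiIncrMeanSquare.MeanSquare.sum_sq_le'`),
Part Z (`LiDescentZeroPositiveLaw`), and the curvature band of `LiSecondOrderCriterion` (`liIncr_le_of_exception`).

This file (`D(N) = #{n < N : λ_{n+1} < λ_n}`): `rh_iff_liDescent_count_le` — `RiemannHypothesis ⟺ ∃ C, ∀ᶠ N, D(N) ≤ C·N/(log N)²`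
(→ file `LiDescentCountingLawRH`; ← Part Z `rh_iff_liDescent_densityZero`) — an RH-EQUIVALENT RELABELLING (T-Li3 family: «λ_n ≤ λ_{n+1} for
almost all n» sharpened to a counting rate); `card_liDescent_ge_linear_of_not_rh` — ¬RH ⟹ `∃ c > 0, ∀ᶠ N, c·N ≤ D(N)` (Part Z's lower density);
`liDescent_count_gap_law` — UNCONDITIONALLY exactly one of «∃ C, ∀ᶠ N, D(N) ≤ C·N/(log N)²» / «∃ c > 0, ∀ᶠ N, c·N ≤ D(N)» holds: the counting
function of Li descents never lives strictly between `N/(log N)²` and `N` (RH enters by excluded middle only; which side holds IS RH).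
Certifies nothing about RH.

HONEST LABEL: «SPLITTING SEARCH over kernel-typed RH-EQUIVALENCES; a splitting A ∧ B ⟹ RH is CONDITIONAL bookkeeping unless A and B are
both proved; nothing here bears on the truth of RH.»
-/

set_option linter.dupNamespace false

noncomputable section

namespace Summit.RiemannHypothesis.RiemannHypothesis.Theorems.Splittings.LiDescentCountingLaw

open Filter Topology Finset
open Literature.NumberTheory.LFunctions Literature.NumberTheory.LFunctions.SchoenfeldBound
open Summit.RiemannHypothesis.RiemannHypothesis.Theorems.LiTheory
open Summit.RiemannHypothesis.RiemannHypothesis.Theorems.Splittings.LiLowZeroBudget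
  (ampM phase phase_mem fourteen_lt_im blockLaw_budget_clause)
open Summit.RiemannHypothesis.RiemannHypothesis.Theorems.Splittings.LiIncrMeanSquare.MeanSquare
  (dirichletBound sum_sq_le')
open Summit.RiemannHypothesis.RiemannHypothesis.Theorems.Splittings.LiIncrBlockLaw (TLi3.card_neg_mul_sq_le)
open Summit.RiemannHypothesis.RiemannHypothesis.Theorems.Splittings.LiIncrHighPart
  (liIncr highPart lowSum liIncr_eq_highPart_add_lowSum highPart_lower)
open Summit.RiemannHypothesis.RiemannHypothesis.Theorems.Splittings.LiIncrBlockLawOfRH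
  (reindex_nat lowSum_eq eventually_sqrt_log_le)
open Summit.RiemannHypothesis.RiemannHypothesis.Theorems.Splittings.LiDescentZeroPositiveLaw
  (rh_iff_liDescent_densityZero liDescent_lower_density_of_not_rh)
open Summit.RiemannHypothesis.RiemannHypothesis.Theorems.Splittings.LiSecondOrderCriterion
  (abs_liSecondDiff_le_of_rh liIncr_le_of_exception)

/-! ## §4 The COUNTING-FUNCTION GAP THEOREM and the kernel RH-equivalent -/

open Classical in
/-- **Kernel RH-equivalent (RELABELLING of RH in the descent-count language):**
`RH ⟺ ∃ C, #{n < N : λ_{n+1} < λ_n} ≤ C·N/(log N)²` for all large `N`.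
(`→` §3; `←`: such a bound forces natural density zero of the descent set, and Part Z's
`rh_iff_liDescent_densityZero` (← = tree T-Li2) gives RH.) -/
theorem rh_iff_liDescent_count_le :
    RiemannHypothesis ↔ ∃ C : ℝ, ∀ᶠ N : ℕ in atTop,
      ((((Finset.range N).filter
          (fun n ↦ n ∈ {n : ℕ | keiperLiCoeff (n + 1) < keiperLiCoeff n})).card : ℕ) : ℝ)
        ≤ C * N / Real.log N ^ 2 := by
  constructor
  · intro hRH
    obtain ⟨C, -, h⟩ := card_liDescent_le_of_rh hRH
    exact ⟨C, h⟩
  · rintro ⟨C, hC⟩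
    refine rh_iff_liDescent_densityZero.2 fun ε hε ↦ ?_
    -- `C / (log N)² ≤ ε` eventually
    have hev : ∀ᶠ N : ℕ in atTop, C ≤ ε * Real.log (N : ℝ) ^ 2 := by
      have ht : Tendsto (fun N : ℕ ↦ ε * Real.log (N : ℝ) ^ 2) atTop atTop := by
        refine Tendsto.const_mul_atTop hε ?_
        exact (tendsto_pow_atTop two_ne_zero).comp
          (Real.tendsto_log_atTop.comp tendsto_natCast_atTop_atTop)
      exact ht.eventually_ge_atTop C
    filter_upwards [hC, hev, eventually_ge_atTop 2] with N hN hCε hN2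
    have hNr : (2 : ℝ) ≤ N := by exact_mod_cast hN2
    have hlog : 0 < Real.log (N : ℝ) := Real.log_pos (by linarith)
    refine hN.trans ?_
    rw [div_le_iff₀ (by positivity)]
    have hN0 : (0 : ℝ) ≤ N := by linarith
    nlinarith [mul_le_mul_of_nonneg_left hCε hN0]

open Classical in
/-- **¬RH ⟹ linear lower bound for the cumulative descent count:** `#{n < N : λ_{n+1} < λ_n} ≥ c·N` for
all large `N`, some `c > 0` (Part Z's syndeticity `liDescent_lower_density_of_not_rh`, re-packaged). -/
theorem card_liDescent_ge_linear_of_not_rh (hRH : ¬ RiemannHypothesis) :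
    ∃ c : ℝ, 0 < c ∧ ∀ᶠ N : ℕ in atTop,
      c * N ≤ ((((Finset.range N).filter
          (fun n ↦ n ∈ {n : ℕ | keiperLiCoeff (n + 1) < keiperLiCoeff n})).card : ℕ) : ℝ) := by
  obtain ⟨L, n₁, hL, hk⟩ := liDescent_lower_density_of_not_rh hRH
  refine ⟨1 / (2 * L), by positivity, ?_⟩
  filter_upwards [eventually_ge_atTop (2 * n₁ + 2 * L)] with N hN
  set k : ℕ := (N - n₁) / L with hkdef
  have hkL : n₁ + k * L ≤ N := by
    have h1 : k * L ≤ N - n₁ := by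
      rw [hkdef]; exact Nat.div_mul_le_self _ _
    omega
  have hmono := card_range_filter_mono hkL
    (fun n ↦ n ∈ {n : ℕ | keiperLiCoeff (n + 1) < keiperLiCoeff n})
  have hcount := (hk k).trans hmono
  have hkr : (k : ℝ) ≤ ((((Finset.range N).filter
      (fun n ↦ n ∈ {n : ℕ | keiperLiCoeff (n + 1) < keiperLiCoeff n})).card : ℕ) : ℝ) := by
    exact_mod_cast hcount
  -- `filter_upwards` has unfolded `n ∈ {n | …}` in the goal (dsimp `Set.mem_setOf_eq`); do the same here
  dsimp only [Set.mem_setOf_eq] at hkr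
  -- `k ≥ (N − n₁)/L − 1 ≥ N/(2L)`
  have hk_lb : (N : ℝ) - n₁ < ((k : ℝ) + 1) * L := by
    have h1 : N - n₁ < (k + 1) * L := by
      rw [hkdef]
      exact (Nat.div_lt_iff_lt_mul (by omega)).1 (Nat.lt_succ_self _)
    have h2 : ((N - n₁ : ℕ) : ℝ) = (N : ℝ) - n₁ := by
      rw [Nat.cast_sub (by omega)]
    have h3 : ((N - n₁ : ℕ) : ℝ) < (((k + 1) * L : ℕ) : ℝ) := by exact_mod_cast h1
    rw [h2] at h3
    push_cast at h3
    linarith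
  have hLr : (1 : ℝ) ≤ L := by exact_mod_cast hL
  have hNr : (2 : ℝ) * n₁ + 2 * L ≤ N := by exact_mod_cast hN
  have hL0 : (0 : ℝ) < L := by linarith
  have hn₁0 : (0 : ℝ) ≤ n₁ := by positivity
  have : 1 / (2 * (L : ℝ)) * N ≤ k := by
    rw [div_mul_eq_mul_div, one_mul, div_le_iff₀ (by positivity)]
    nlinarith
  linarith

open Classical in
/-- **THE COUNTING-FUNCTION GAP THEOREM (unconditional, kernel).** The cumulative descent count
`A(N) = #{n < N : λ_{n+1} < λ_n}` of the Keiper–Li sequence satisfies EXACTLY ONE of: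
(a) `A(N) ≤ C·N/(log N)²` for all large `N` (⟺ RH), or (b) `A(N) ≥ c·N` for all large `N`, some `c > 0` (⟺ ¬RH).
Every intermediate order of magnitude (`N/log N`, `N^{0.99}`, …) is excluded. Which alternative holds is the
Riemann Hypothesis, on which nothing here bears. -/
theorem liDescent_count_gap_law :
    ((∃ C : ℝ, ∀ᶠ N : ℕ in atTop,
        ((((Finset.range N).filter
            (fun n ↦ n ∈ {n : ℕ | keiperLiCoeff (n + 1) < keiperLiCoeff n})).card : ℕ) : ℝ)
          ≤ C * N / Real.log N ^ 2) ∧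
      ¬ ∃ c : ℝ, 0 < c ∧ ∀ᶠ N : ℕ in atTop,
        c * N ≤ ((((Finset.range N).filter
            (fun n ↦ n ∈ {n : ℕ | keiperLiCoeff (n + 1) < keiperLiCoeff n})).card : ℕ) : ℝ)) ∨
    ((∃ c : ℝ, 0 < c ∧ ∀ᶠ N : ℕ in atTop,
        c * N ≤ ((((Finset.range N).filter
            (fun n ↦ n ∈ {n : ℕ | keiperLiCoeff (n + 1) < keiperLiCoeff n})).card : ℕ) : ℝ)) ∧
      ¬ ∃ C : ℝ, ∀ᶠ N : ℕ in atTop,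
        ((((Finset.range N).filter
            (fun n ↦ n ∈ {n : ℕ | keiperLiCoeff (n + 1) < keiperLiCoeff n})).card : ℕ) : ℝ)
          ≤ C * N / Real.log N ^ 2) := by
  -- the two alternatives are incompatible: `c N ≤ C N / log² N` fails for large `N`
  have hincomp : ∀ C c : ℝ, 0 < c →
      (∀ᶠ N : ℕ in atTop,
        ((((Finset.range N).filter
            (fun n ↦ n ∈ {n : ℕ | keiperLiCoeff (n + 1) < keiperLiCoeff n})).card : ℕ) : ℝ)
          ≤ C * N / Real.log N ^ 2) →
      (∀ᶠ N : ℕ in atTop,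
        c * N ≤ ((((Finset.range N).filter
            (fun n ↦ n ∈ {n : ℕ | keiperLiCoeff (n + 1) < keiperLiCoeff n})).card : ℕ) : ℝ)) →
      False := by
    intro C c hc hU hL
    have hev : ∀ᶠ N : ℕ in atTop, C < c * Real.log (N : ℝ) ^ 2 := by
      have ht : Tendsto (fun N : ℕ ↦ c * Real.log (N : ℝ) ^ 2) atTop atTop :=
        Tendsto.const_mul_atTop hc ((tendsto_pow_atTop two_ne_zero).comp
          (Real.tendsto_log_atTop.comp tendsto_natCast_atTop_atTop))
      exact ht.eventually_gt_atTop C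
    obtain ⟨N, hN⟩ := (((hU.and hL).and hev).and (eventually_ge_atTop 2)).exists
    obtain ⟨⟨⟨hN1, hN2⟩, hN3⟩, hN4⟩ := hN
    have hNr : (2 : ℝ) ≤ N := by exact_mod_cast hN4
    have hlog : 0 < Real.log (N : ℝ) := Real.log_pos (by linarith)
    have h := hN2.trans hN1
    rw [le_div_iff₀ (by positivity)] at h
    have hN0 : (0 : ℝ) < N := by linarith
    nlinarith [mul_lt_mul_of_pos_left hN3 hN0]
  by_cases hRH : RiemannHypothesis
  · left
    obtain ⟨C, -, hC⟩ := card_liDescent_le_of_rh hRH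
    exact ⟨⟨C, hC⟩, fun ⟨c, hc, hL⟩ ↦ hincomp C c hc hC hL⟩
  · right
    obtain ⟨c, hc, hL⟩ := card_liDescent_ge_linear_of_not_rh hRH
    exact ⟨⟨c, hc, hL⟩, fun ⟨C, hC⟩ ↦ hincomp C c hc hC hL⟩

end Summit.RiemannHypothesis.RiemannHypothesis.Theorems.Splittings.LiDescentCountingLaw
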